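import Literature.AnabelianGeometry.EtaleTheta.SettingModelKrullMuTwoInversion
import Literature.AnabelianGeometry.EtaleTheta.SettingModelChiNoCommAxisCusp
import Literature.AnabelianGeometry.EtaleTheta.RootsOfUnityGaloisPrimePower
import Literature.AnabelianGeometry.SemiGraphs.TemperedCurveGroupLevelDataNonVacuity2
import HarnessLib

/-!
# The profinite `Π_C` of the cusped untwisted Krull model is SLIM; `Ẑ`-lemmas; conjugation by `a^Ẑ`
# (proof-only tools for «[EtTh] Prop. 2.4 / 2.6 AS TYPED are false at the κ′ cover datum»)

S. Mochizuki, *The étale theta function and its Frobenioid-theoretic manifestations*, Publ. RIMS **45** (2009)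
[EtTh], §1 p. 12 («`Δ_X` … a profinite free group on 2 generators», «`Π^tp_X ↠ Z`»), §2 Prop. 2.4 p. 38
[cite: MochizukiEtTh2009, Prop 2.4 p.38]. Cell abc-iut, layer L2, seat abc-iut-f-151 (gen 3); question
Q-L2t10g6-P26κ′ of the L2 census. PROOF-ONLY (0 definitions, no instance, no new `Prop`).

Over abc-iut-L2-t10's κ′ carriers (`SettingModelKrullSemidirect` / `…KrullPiC` / `…KrullPiCInv` /
`…KrullMuTwoInversion`): `Π^tp_X = Γ ⋊_1 G_{ℚ_p}` (`Γ = F̂₂ ×_Ẑ ℤ`), `Π_X = F̂₂ ⋊_1 G_{ℚ_p}`,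
`Π_C = Π_X ⋊_{ι̂} ℤ/2` (`ι̂ = σ̂ ⋊ id`, `σ̂` REVERSES the degree `ê : F̂₂ → Ẑ`), this file proves:
* §1 `isSlimGroup_PiHtκ`, **`isSlimGroup_PiCκ`** — the PROFINITE `Π_X`, `Π_C` of the model are slim (`F̂₂` slim:
  abc-iut-L3's `isSlimGroup_profiniteCompletion_freeGroupTwo`; `G_{ℚ_p}` slim: [pGC] Lem. 15.8 in the tree;
  the `ℤ/2`-step: `ι̂` cannot be inner on an open subgroup of `Π_X` because it reverses `ê`);
* §2 `zh_eq_one_of_pow_eq_one` (`Ẑ` is torsion-free), `exists_chi_eta_not_mem_range` (a value of the cyclotomic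
  character `χ(σ)(1) ∉ ℤ`, from abc-iut's `exists_levelChar_chi_eq` at level `p³`), `exists_pow_sq_ne_eta`
  (`∀ N ≠ 0 ∃ s ∈ Ẑ, (s^N)² ∉ ℤ`);
* §3 `exists_aPowHat` (the one-parameter subgroup `a^Ẑ ⊆ F̂₂` with `ê(a^t) = t`) and `exists_conjHatAut`
  (conjugation by ANY `f ∈ F̂₂` is a topological automorphism of the TEMPERED `Π^tp_X`, read in `Π_X` as
  conjugation by `inl f` — possible because the Galois action on `F̂₂` is trivial and `ê` is conjugation-invariant).

HONEST FRAMING: SEMI-SYNTHETIC model — consistency / non-vacuity tooling for OUR typed interface only; nothing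
of [EtTh]/[SemiAnbd] is asserted; no side is taken on [IUTchIII] Cor. 3.12; typed ≠ proved.
-/

noncomputable section

namespace Literature.AnabelianGeometry.EtaleTheta.SettingModel

open Literature.AnabelianGeometry.SemiGraphs
open Literature.AlgebraicGeometry.Frobenioids (IsSlimGroup)
open _root_.Topology _root_.Function

variable (p : ℕ) [hp : Fact p.Prime]

/-! ## §1. The profinite `Π_C = (F̂₂ ⋊_1 G_{ℚ_p}) ⋊_{ι̂} ℤ/2` of the κ′ model is SLIM -/

/-- The completed Galois action of the κ′ root on `F̂₂` is trivial. [cite: MochizukiEtTh2009, §1 p.12] -/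
theorem actHatκ_apply_eq (σ : GQp p) (y : F₂hatT) : actHatκ p σ y = y := by
  rw [actHatκ_apply, MonoidHom.one_apply, twist_one]

/-- Left components multiply in `Π_X = F̂₂ ⋊_1 G_{ℚ_p}` (trivial action). [cite: MochizukiEtTh2009, §1 p.12] -/
theorem mul_left_PiHtκ (z w : PiHtκ p) : (z * w).left = z.left * w.left := by
  rw [SemidirectProduct.mul_left, actHatκ_apply_eq]

/-- `Ẑ` is commutative (checked levelwise on the `ℤ/nℤ`; a private copy of abc-iut-f-151 g2's lemma of the same
name in `Sec2Cor219iiiStdTwistAut`, kept local to avoid that file's imports). [cite: RibesZalesskii2010, Thm 2.7.1] -/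
private theorem zh_comm_levelwise (x y : ZH) : x * y = y * x :=
  ZHatLevel.ext_of_level fun n => by rw [map_mul, map_mul, mul_comm]

/-- `ê` is conjugation-invariant: `ê(g x g⁻¹) = ê(x)`. [cite: MochizukiEtTh2009, §1 p.12] -/
theorem eHat_conj (g x : F₂hatT) : eHat (g * x * g⁻¹) = eHat x := by
  rw [map_mul, map_mul, map_inv, zh_comm_levelwise (eHat g) (eHat x), mul_inv_cancel_right]

/-- **`Π_X = F̂₂ ⋊_1 G_{ℚ_p}` is slim** (`F̂₂` slim: abc-iut-L3; `G_{ℚ_p}` slim: [pGC] Lem. 15.8 in the tree).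
[cite: MochizukiSemiAnbd2006, Ex 3.10 p.43] -/
theorem isSlimGroup_PiHtκ : IsSlimGroup (PiHtκ p) :=
  Semidirect.isSlimGroup_of (isInducing_leftRightHatκ p) isSlimGroup_profiniteCompletion_freeGroupTwo
    (Literature.AnabelianGeometry.AbsoluteAnabelian.IsSubpadicFor.isSlimGroup_absoluteGaloisGroup
      (Literature.AnabelianGeometry.AbsoluteAnabelian.AbsTopIII.IsSubpadicFor.padic p))

/-- An open subgroup of `Π_X` contains `η(g)^N` for some `g ∈ F₂` of degree `1` and some `N ≠ 0`.
[cite: MochizukiEtTh2009, §1 p.12] -/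
theorem exists_pow_mem_of_isOpen_PiHtκ (A : Subgroup (PiHtκ p)) (hA : IsOpen (A : Set (PiHtκ p))) :
    ∃ (g : F₂) (N : ℕ), expA g = Multiplicative.ofAdd 1 ∧ N ≠ 0 ∧
      (SemidirectProduct.inl (eta g ^ N) : PiHtκ p) ∈ A := by
  obtain ⟨g, hg⟩ := expA_surjective (Multiplicative.ofAdd 1)
  haveI : Finite (PiHtκ p ⧸ A) := A.quotient_finite_of_isOpen hA
  haveI : A.FiniteIndex := Subgroup.finiteIndex_of_finite_quotient
  refine ⟨g, A.normalCore.index, hg, Subgroup.FiniteIndex.index_ne_zero, ?_⟩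
  rw [map_pow]
  exact A.normalCore_le (Subgroup.pow_index_mem A.normalCore _)

/-- **`Π_C = Π_X ⋊_{ι̂} ℤ/2` of the κ′ model is SLIM**: an element centralising an open `U` has trivial
`ℤ/2`-component — otherwise `ι̂` would be inner on the open slice `U ∩ Π_X`, impossible since `ι̂` REVERSES the
degree `ê` while inner automorphisms preserve it (test on a power of the degree-`1` generator) — and then its
`Π_X`-component centralises `U ∩ Π_X`, so is trivial (`isSlimGroup_PiHtκ`). [cite: MochizukiEtTh2009, Prop 2.4 p.38] -/
theorem isSlimGroup_PiCκ : IsSlimGroup (PiCκ p) := by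
  refine ⟨fun U hU => ?_⟩
  rw [eq_bot_iff]
  intro z hz
  rw [Subgroup.mem_centralizer_iff] at hz
  let A : Subgroup (PiHtκ p) := U.comap (SemidirectProduct.inl : PiHtκ p →* PiCκ p)
  have hAo : IsOpen (A : Set (PiHtκ p)) := hU.preimage (Semidirect.continuous_inl (isInducing_leftRightCκ p))
  have key : ∀ t : Multiplicative (ZMod 2), t = 1 ∨ t = Multiplicative.ofAdd 1 := by decide
  -- the commutation relation on the slice `A = U ∩ Π_X`
  have hconj : ∀ a ∈ A, a * z.left = z.left * hatInvActionκ p z.right a := fun a ha => by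
    have h := congrArg SemidirectProduct.left (hz (SemidirectProduct.inl a) ha)
    rwa [SemidirectProduct.mul_left, SemidirectProduct.mul_left, SemidirectProduct.left_inl,
      SemidirectProduct.right_inl, map_one, MulAut.one_apply] at h
  have hzr : z.right = 1 := by
    rcases key z.right with h | h
    · exact h
    · exfalso
      obtain ⟨g, N, hg, hN, hmem⟩ := exists_pow_mem_of_isOpen_PiHtκ p A hAo
      have h1 := congrArg (fun w : PiHtκ p => eHat w.left) (hconj _ hmem)
      rw [h, hatInvActionκ_ofAdd_one, mul_left_PiHtκ, mul_left_PiHtκ, hatInvκ_left, SemidirectProduct.left_inl,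
        map_mul, map_mul, eHat_sigmaHat, zh_comm_levelwise, mul_right_inj, map_pow, eHat_eta, hg, ← map_pow,
        ← map_inv] at h1
      have h2 := iotaZ_injective h1
      rw [← inv_pow, ← ofAdd_nsmul, ← ofAdd_neg, ← ofAdd_nsmul, smul_neg, nsmul_eq_mul, mul_one] at h2
      have h3 := Multiplicative.ofAdd.injective h2
      omega
  have hzl : z.left = 1 := by
    have hc : z.left ∈ Subgroup.centralizer (A : Set (PiHtκ p)) := by
      rw [Subgroup.mem_centralizer_iff]
      intro a ha
      have h := hconj a ha
      rwa [hzr, map_one, MulAut.one_apply] at h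
    rw [(isSlimGroup_PiHtκ p).centralizer_eq_bot _ hAo, Subgroup.mem_bot] at hc
    exact hc
  rw [Subgroup.mem_bot, ← SemidirectProduct.inl_left_mul_inr_right z, hzr, hzl, map_one, map_one, mul_one]

/-! ## §2. `Ẑ`: torsion-freeness and a non-integral value of the cyclotomic character -/

/-- `ι(k) = η(k)`: the two spellings of `ℤ ⊆ Ẑ` in the tree agree. [cite: MochizukiEtTh2009, §1 p.12] -/
theorem iotaZ_ofAdd (k : ℤ) : iotaZ (Multiplicative.ofAdd k) = ZHatLevel.eta k := rfl

/-- **`Ẑ` is torsion-free**: `x^k = 1` with `k ≠ 0` forces `x = 1` (levelwise: `k · x ≡ 0 (mod nk)` gives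
`x ≡ 0 (mod n)` for every `n`). [cite: RibesZalesskii2010, Thm 2.7.1] -/
theorem zh_eq_one_of_pow_eq_one {x : ZH} {k : ℕ} (hk : k ≠ 0) (h : x ^ k = 1) : x = 1 := by
  refine ZHatLevel.ext_of_level fun n => ?_
  let K : ℕ+ := ⟨k, Nat.pos_of_ne_zero hk⟩
  haveI : NeZero ((n * K : ℕ+) : ℕ) := NeZero.of_pos (n * K).pos
  obtain ⟨m, hm⟩ : ∃ m : ℕ, (m : ZMod ((n * K : ℕ+) : ℕ)) = Multiplicative.toAdd (ZHatLevel.level (n * K) x) :=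
    ⟨_, ZMod.natCast_zmod_val _⟩
  have hpow : Multiplicative.toAdd (ZHatLevel.level (n * K) (x ^ k)) = 0 := by rw [h, map_one, toAdd_one]
  rw [map_pow, toAdd_pow, nsmul_eq_mul, ← hm, ← Nat.cast_mul, ZMod.natCast_eq_zero_iff] at hpow
  have hpow' : k * (n : ℕ) ∣ k * m := by
    have h' : ((n * K : ℕ+) : ℕ) = k * (n : ℕ) := by rw [PNat.mul_coe, PNat.mk_coe, mul_comm]
    rw [← h']; exact hpow
  have hdvd : (n : ℕ) ∣ m := Nat.dvd_of_mul_dvd_mul_left (Nat.pos_of_ne_zero hk) hpow'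
  have hc' : ZMod.castHom (dvd_mul_right (n : ℕ) K) (ZMod n) (m : ZMod ((n : ℕ) * (K : ℕ))) =
      Multiplicative.toAdd (ZHatLevel.level n x) :=
    (congrArg (ZMod.castHom (dvd_mul_right (n : ℕ) K) (ZMod n)) hm).trans (ZHatLevel.cast_level_mul n K x)
  rw [map_natCast, (ZMod.natCast_eq_zero_iff m n).mpr hdvd] at hc'
  rw [map_one, ← ofAdd_toAdd (ZHatLevel.level n x), ← hc', ofAdd_zero]

include hp in
/-- **A value of the cyclotomic character that is not an integer**: for `σ ∈ G_{ℚ_p}` with `χ_{p³}(σ) = 1 + p`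
(abc-iut's `exists_levelChar_chi_eq`), `χ(σ)(1) ∉ ℤ ⊆ Ẑ` — an integer `k` with `χ_n(σ) ≡ k` a unit mod every
`n` is `±1`, and `1 + p ≢ ±1 (mod p³)`. [cite: SerreLocalFields1979, IV §4 Prop 17] -/
theorem exists_chi_eta_not_mem_range : ∃ s : ZH, ∀ k : ℤ, s ≠ ZHatLevel.eta k := by
  obtain ⟨σ, hσ⟩ := exists_levelChar_chi_eq p (k := 3) (by norm_num) (isUnit_one_add_prime_zmod_cube p).unit
  rw [IsUnit.unit_spec] at hσ
  refine ⟨chi p σ (ZHatLevel.eta 1), fun k hk => ?_⟩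
  have hlc : ∀ n : ℕ+, ZHatLevel.levelChar n (chi p σ) = (k : ZMod n) := fun n => by
    rw [ZHatLevel.levelChar_apply, hk, ZHatLevel.level_eta, toAdd_ofAdd]
  have hu : ∀ n : ℕ+, IsUnit ((k : ZMod n)) := fun n => hlc n ▸ isUnit_levelChar_chi p n σ
  have h3 : 1 < p ^ 3 := Nat.one_lt_pow (by norm_num) hp.out.one_lt
  have hk1 : k.natAbs = 1 := by
    by_contra hne
    rcases Nat.lt_or_gt_of_ne hne with hlt | hgt
    · have hk0 : k = 0 := Int.natAbs_eq_zero.mp (by omega)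
      haveI : Fact (1 < p ^ 3) := ⟨h3⟩
      have h : IsUnit ((k : ZMod (p ^ 3))) := hu ⟨p ^ 3, pow_pos hp.out.pos 3⟩
      rw [hk0, Int.cast_zero] at h
      exact not_isUnit_zero h
    · haveI : Fact (1 < k.natAbs) := ⟨hgt⟩
      haveI : NeZero k.natAbs := ⟨by omega⟩
      have h : IsUnit ((k : ZMod k.natAbs)) := hu ⟨k.natAbs, by omega⟩
      have h0 : ((k : ZMod k.natAbs)) = 0 := by
        rw [ZMod.intCast_zmod_eq_zero_iff_dvd]
        exact Int.natAbs_dvd.mpr (dvd_refl k)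
      rw [h0] at h
      exact not_isUnit_zero h
  have h := hlc ⟨p ^ 3, pow_pos hp.out.pos 3⟩
  rw [hσ] at h
  have h' : (1 : ZMod (p ^ 3)) + (p : ZMod (p ^ 3)) = (k : ZMod (p ^ 3)) := h
  rcases Int.natAbs_eq k with hk' | hk' <;> rw [hk1, Nat.cast_one] at hk' <;> rw [hk'] at h'
  · exact one_add_prime_ne_one_zmod_cube p (by rw [h', Int.cast_one])
  · exact one_add_prime_ne_neg_one_zmod_cube p (by rw [h', Int.cast_neg, Int.cast_one])

include hp in
/-- For every `N ≠ 0` there is `s ∈ Ẑ` with `(s^N)² ∉ ℤ`: for the `s ∉ ℤ` of `exists_chi_eta_not_mem_range`,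
`s^{2N} = η(m)` forces `2N ∣ m` (reduce mod `2N`) and then `(s·η(m/2N)⁻¹)^{2N} = 1`, so `s ∈ ℤ` by
torsion-freeness. [cite: RibesZalesskii2010, Thm 2.7.1] -/
theorem exists_pow_sq_ne_eta (N : ℕ) (hN : N ≠ 0) : ∃ s : ZH, ∀ m : ℤ, (s ^ N) ^ 2 ≠ ZHatLevel.eta m := by
  obtain ⟨s, hs⟩ := exists_chi_eta_not_mem_range p
  refine ⟨s, fun m hm => ?_⟩
  rw [← pow_mul] at hm
  let M : ℕ+ := ⟨N * 2, by omega⟩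
  haveI : NeZero ((M : ℕ+) : ℕ) := NeZero.of_pos M.pos
  have hlev : ZHatLevel.level M (ZHatLevel.eta m) = 1 := by rw [← hm]; exact ZHatLevel.level_pow_self M s
  rw [ZHatLevel.level_eta, ofAdd_eq_one, ZMod.intCast_zmod_eq_zero_iff_dvd] at hlev
  obtain ⟨m', rfl⟩ := hlev
  have hm' : ZHatLevel.eta ((M : ℕ) * m' : ℤ) = ZHatLevel.eta m' ^ (N * 2) := by
    rw [ZHatLevel.eta_eq_zpow, mul_comm, zpow_mul, ← ZHatLevel.eta_eq_zpow, PNat.mk_coe, zpow_natCast]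
  rw [hm'] at hm
  have hcomm : Commute s (ZHatLevel.eta m')⁻¹ := zh_comm_levelwise _ _
  have h1 : (s * (ZHatLevel.eta m')⁻¹) ^ (N * 2) = 1 := by rw [hcomm.mul_pow, inv_pow, hm, mul_inv_cancel]
  exact hs m' (mul_inv_eq_one.mp (zh_eq_one_of_pow_eq_one (by omega) h1))

/-! ## §3. The one-parameter subgroup `a^Ẑ ⊆ F̂₂` and conjugation by its elements on `Π^tp_X` -/

/-- **`a^· : Ẑ → F̂₂`** exists as a continuous homomorphism with `a^{ι k} = η(a)^k` and `ê(a^t) = t`.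
[cite: MochizukiEtTh2009, §1 p.12] -/
theorem exists_aPowHat : ∃ A : ZH →ₜ* F₂hatT,
    (∀ k : Multiplicative ℤ, A (iotaZ k) = eta (FreeGroup.of 0) ^ Multiplicative.toAdd k) ∧ ∀ t, eHat (A t) = t := by
  let A : ZH →ₜ* F₂hatT :=
    (ProfiniteGrp.ProfiniteCompletion.lift (P := F₂hat)
      (GrpCat.ofHom (zpowersHom F₂hatT (eta (FreeGroup.of 0))))).hom
  have hA : ∀ k : Multiplicative ℤ, A (iotaZ k) = eta (FreeGroup.of 0) ^ Multiplicative.toAdd k := fun k =>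
    lift_hom_toCompletion F₂hat (zpowersHom F₂hatT (eta (FreeGroup.of 0))) k
  refine ⟨A, hA, fun t => ?_⟩
  have h := Literature.AnabelianGeometry.AbsoluteAnabelian.ZHatCompletion.monoidHom_ext_of_continuous
    (f₁ := eHat.toMonoidHom.comp A.toMonoidHom) (f₂ := MonoidHom.id ZH)
    (eHat.continuous.comp A.continuous) continuous_id (by
      change eHat (A (iotaZ (Multiplicative.ofAdd 1))) = iotaZ (Multiplicative.ofAdd 1)
      rw [hA, toAdd_ofAdd, zpow_one, eHat_eta, expA_apply, heisHom_of_zero])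
  exact DFunLike.congr_fun h t

/-- **Conjugation by `f ∈ F̂₂` on `Π^tp_X = Γ ⋊_1 G_{ℚ_p}`** is a topological automorphism (`Γ ⊴ F̂₂ × ℤ` as
`ê` is conjugation-invariant; the Galois action is trivial), read in `Π_X` as conjugation by `inl f`.
[cite: MochizukiEtTh2009, §1 p.12] -/
theorem exists_conjHatAut (f : F₂hatT) : ∃ α : PiTpκ p ≃ₜ* PiTpκ p,
    ∀ x, toHatκ p (α x) = SemidirectProduct.inl f * toHatκ p x * (SemidirectProduct.inl f)⁻¹ := by
  let c : ∀ _ : F₂hatT, Gfp → Gfp := fun g γ => ⟨(g * γ.1.1 * g⁻¹, γ.1.2), by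
    rw [mem_Gfp]; change eHat (g * γ.1.1 * g⁻¹) = iotaZ γ.1.2
    rw [eHat_conj]; exact (mem_Gfp _).mp γ.2⟩
  have hc_mul : ∀ g (γ δ : Gfp), c g (γ * δ) = c g γ * c g δ := fun g γ δ =>
    Subtype.ext (Prod.ext (by change g * (γ.1.1 * δ.1.1) * g⁻¹ = g * γ.1.1 * g⁻¹ * (g * δ.1.1 * g⁻¹); group) rfl)
  have hc_inv : ∀ g (γ : Gfp), c g⁻¹ (c g γ) = γ := fun g γ =>
    Subtype.ext (Prod.ext (by change g⁻¹ * (g * γ.1.1 * g⁻¹) * g⁻¹⁻¹ = γ.1.1; group) rfl)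
  have hc_cont : ∀ g, Continuous (c g) := fun g =>
    (((continuous_const.mul (continuous_fst.comp continuous_subtype_val)).mul continuous_const).prodMk
      (continuous_snd.comp continuous_subtype_val)).subtype_mk _
  let F : ∀ _ : F₂hatT, PiTpκ p → PiTpκ p := fun g x => ⟨c g x.left, x.right⟩
  have hF_mul : ∀ g (x y : PiTpκ p), F g (x * y) = F g x * F g y := fun g x y => by
    refine SemidirectProduct.ext ?_ rfl
    change c g (x * y).left = c g x.left * actκ p x.right (c g y.left)
    rw [SemidirectProduct.mul_left, actκ_apply_eq, actκ_apply_eq, hc_mul]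
  have hF_inv : ∀ g (x : PiTpκ p), F g⁻¹ (F g x) = x := fun g x => SemidirectProduct.ext (hc_inv g x.left) rfl
  have hF_cont : ∀ g, Continuous (F g) := fun g =>
    (isInducing_leftRightκ p).continuous_iff.mpr
      (((hc_cont g).comp (Semidirect.continuous_left (isInducing_leftRightκ p))).prodMk
        (Semidirect.continuous_right (isInducing_leftRightκ p)))
  let e : PiTpκ p ≃* PiTpκ p :=
    { toFun := F f
      invFun := F f⁻¹
      left_inv := hF_inv f
      right_inv := fun x => by have h := hF_inv f⁻¹ x; rwa [inv_inv] at h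
      map_mul' := hF_mul f }
  refine ⟨ContinuousMulEquiv.mk e (hF_cont f) (hF_cont f⁻¹), fun x => SemidirectProduct.ext ?_ ?_⟩
  · change gfpFst (c f x.left) = _
    rw [SemidirectProduct.mul_left, SemidirectProduct.mul_left, SemidirectProduct.left_inl, SemidirectProduct.right_inl,
      map_one, MulAut.one_apply, actHatκ_apply_eq, SemidirectProduct.inv_left, actHatκ_apply_eq,
      SemidirectProduct.left_inl]
    rfl
  · change x.right = _
    rw [SemidirectProduct.mul_right, SemidirectProduct.mul_right, SemidirectProduct.right_inl,
      SemidirectProduct.inv_right, SemidirectProduct.right_inl, inv_one, one_mul, mul_one, toHatκ_right]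

end Literature.AnabelianGeometry.EtaleTheta.SettingModel

end
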